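import Summits.QuantumFields.YangMills.Theorems.LuscherReductionRunningReductionLatticeLinkKernel
import Summits.QuantumFields.YangMills.Theorems.LuscherReductionRunningReductionTraceFormulaAveraging
import Mathlib.Topology.Order.Compact
import HarnessLib

/-!
# The gauge-orbit distance to the classical vacuum on `(ℤ/L)³` (sub-stub C2a of the fixed-lattice programme COARSE(L₀) — route `LuscherReduction`,
# crux RED stmt-QuantumFields-19978 KT-door 3b′ / crux `TwistedTraceScaling` stmt-QuantumFields-20203 S-BASE; design note
# `pub/ym-fleet/ym-luscher-20007-p1/COARSE-DESIGN.md` §2)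

Every IMS localisation of the zero-flux transfer form on the `L³` torus needs GAUGE-INVARIANT, LINK-LIPSCHITZ cut-offs separating the
neighbourhood of the pure-gauge orbit of the classical vacuum `1̄` (the INNER region, where the Born–Oppenheimer comparison with the one-site
model lives) from the valley and the large fields.  At one site (crux ONE) the per-link distance to the centre `vacDist(U_e)` did this job,
because there gauge = simultaneous conjugation.  On the torus the invariant object is the distance to the ORBIT:

  `orbitDist U = inf_{g : Site → SU(2)} Σ_e ‖(U^g)_e − 1‖_F`   (`U^g = gaugeTransform g U`; `ℓ¹` sum of Frobenius distances).

This module defines it and proves the properties the IMS machinery (`qform_le_localized_cos_sin_lat`, p527446) consumes: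
* `orbitDist_le` / `orbitDist_nonneg` / `exists_orbitDist_eq` (the infimum is attained: the gauge group `SU(2)^{L³}` is compact);
* `orbitDist_gaugeTransform` — gauge invariance; `orbitDist_pureGauge` — it vanishes on pure gauges `(g_x g_{x+ê}⁻¹)`;
* `abs_orbitDist_sub_le` — **link-Lipschitz with constant 1**: `|orbitDist U − orbitDist V| ≤ Σ_e ‖U_e − V_e‖_F` (unitary invariance of
  the Frobenius norm under the same gauge transformation of `U` and `V`);
* `abs_orbitDist_twist3_sub_le` — composite centre twists do not change link distances BETWEEN configurations, so
  `|orbitDist (twist3 z U) − orbitDist (twist3 z V)| ≤ Σ_e ‖U_e − V_e‖_F` as well; `orbitDist_twist3_gaugeTransform` (gauge invariance of the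
  twisted distances);
* `continuous_orbitDist`, `measurable_orbitDist`.
`orbitDist` is NOT twist-invariant (the torons `twist3 z 1̄` are far from the orbit of `1̄`); the twist-symmetrised INNER phase built from
`orbitDist ∘ twist3 z`, `z : Fin 3 → Bool`, is the next module.  HONEST FRAMING: definitions and soft properties only; femto rung R2b1; not a
gap, not Clay.
-/

set_option autoImplicit false

noncomputable section

open MeasureTheory Filter Topology Real
open scoped Matrix ComplexConjugate BigOperators Matrix.Norms.Frobenius
open Literature.MathematicalPhysics.QuantumFieldTheory
open Literature.MathematicalPhysics.QuantumLattice

namespace Summit.QuantumFields.YangMills.Theorems.FemtoTransferGap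

variable {L : ℕ} [NeZero L]

/-! ## §1 The gauge-fixed distance and the orbit distance -/

/-- The `ℓ¹`-Frobenius distance of the gauge transform `U^g` to the classical vacuum `1̄`: `Σ_e ‖(U^g)_e − 1‖_F`. [folklore] -/
def gaugeDist (g : Site 3 L → SU2) (U : GaugeConfig 3 L SU2) : ℝ :=
  ∑ e : Edge 3 L, frobNorm (((gaugeTransform g U e : SU2) : Matrix (Fin 2) (Fin 2) ℂ) - 1)

/-- **Gauge-orbit distance to the vacuum**: `orbitDist U = inf_g Σ_e ‖(U^g)_e − 1‖_F` over all gauge transformations `g : (ℤ/L)³ → SU(2)`.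
[cite: Luscher1983, §2] -/
def orbitDist (U : GaugeConfig 3 L SU2) : ℝ :=
  sInf (Set.range fun g : Site 3 L → SU2 => gaugeDist g U)

/-- `gaugeDist ≥ 0`. [folklore] -/
theorem gaugeDist_nonneg (g : Site 3 L → SU2) (U : GaugeConfig 3 L SU2) : 0 ≤ gaugeDist g U :=
  Finset.sum_nonneg fun _ _ => frobNorm_nonneg _

/-- The range of `gaugeDist · U` is bounded below by `0`. [folklore] -/
theorem bddBelow_range_gaugeDist (U : GaugeConfig 3 L SU2) : BddBelow (Set.range fun g : Site 3 L → SU2 => gaugeDist g U) :=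
  ⟨0, by rintro _ ⟨g, rfl⟩; exact gaugeDist_nonneg g U⟩

/-- `orbitDist U ≤ Σ_e ‖(U^g)_e − 1‖_F` for every gauge transformation `g`. [folklore] -/
theorem orbitDist_le (g : Site 3 L → SU2) (U : GaugeConfig 3 L SU2) : orbitDist U ≤ gaugeDist g U :=
  csInf_le (bddBelow_range_gaugeDist U) ⟨g, rfl⟩

/-- `0 ≤ orbitDist U`. [folklore] -/
theorem orbitDist_nonneg (U : GaugeConfig 3 L SU2) : 0 ≤ orbitDist U :=
  le_csInf ⟨_, ⟨1, rfl⟩⟩ (by rintro _ ⟨g, rfl⟩; exact gaugeDist_nonneg g U)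

/-- `gaugeDist` is jointly continuous in `(U, g)`. [folklore] -/
theorem continuous_gaugeDist_uncurry :
    Continuous (Function.uncurry fun (U : GaugeConfig 3 L SU2) (g : Site 3 L → SU2) => gaugeDist g U) := by
  unfold gaugeDist
  refine continuous_finsetSum _ fun e _ => continuous_frobNorm'.comp ?_
  refine (continuous_subtype_val.comp ?_).sub continuous_const
  -- `(U,g) ↦ g x * U e * (g y)⁻¹`
  show Continuous fun p : GaugeConfig 3 L SU2 × (Site 3 L → SU2) => gaugeTransform p.2 p.1 e
  simp only [gaugeTransform]
  exact (((continuous_apply e.1).comp continuous_snd).mul ((continuous_apply e).comp continuous_fst)).mul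
    ((continuous_apply (e.1.shift e.2)).comp continuous_snd).inv

/-- `gaugeDist · U` is continuous on the gauge group. [folklore] -/
theorem continuous_gaugeDist_right (U : GaugeConfig 3 L SU2) : Continuous fun g : Site 3 L → SU2 => gaugeDist g U :=
  continuous_gaugeDist_uncurry.uncurry_left U

/-- **The infimum is attained** (the gauge group `SU(2)^{(ℤ/L)³}` is compact). [folklore] -/
theorem exists_orbitDist_eq (U : GaugeConfig 3 L SU2) : ∃ g : Site 3 L → SU2, gaugeDist g U = orbitDist U := by
  obtain ⟨g, -, hg⟩ := isCompact_univ.exists_isMinOn (f := fun g : Site 3 L → SU2 => gaugeDist g U) Set.univ_nonempty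
    (continuous_gaugeDist_right U).continuousOn
  refine ⟨g, le_antisymm ?_ (orbitDist_le g U)⟩
  exact le_csInf ⟨_, ⟨1, rfl⟩⟩ (by rintro _ ⟨h, rfl⟩; exact hg (Set.mem_univ h))

/-! ## §2 Invariance and the pure gauges -/

/-- `gaugeDist g (U^h) = gaugeDist (g h) U` (gauge transformations compose). [folklore] -/
theorem gaugeDist_gaugeTransform (g h : Site 3 L → SU2) (U : GaugeConfig 3 L SU2) :
    gaugeDist g (gaugeTransform h U) = gaugeDist (g * h) U := by
  unfold gaugeDist
  rw [TT.gaugeTransform_gaugeTransform]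

/-- **Gauge invariance**: `orbitDist (U^h) = orbitDist U` (the orbit is the same). [folklore] -/
theorem orbitDist_gaugeTransform (h : Site 3 L → SU2) (U : GaugeConfig 3 L SU2) :
    orbitDist (gaugeTransform h U) = orbitDist U := by
  have hr : (Set.range fun g : Site 3 L → SU2 => gaugeDist g (gaugeTransform h U)) =
      Set.range fun g : Site 3 L → SU2 => gaugeDist g U := by
    apply Set.Subset.antisymm
    · rintro r ⟨g, rfl⟩
      exact ⟨g * h, (gaugeDist_gaugeTransform g h U).symm⟩
    · rintro r ⟨g, rfl⟩
      refine ⟨g * h⁻¹, ?_⟩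
      show gaugeDist (g * h⁻¹) (gaugeTransform h U) = gaugeDist g U
      rw [gaugeDist_gaugeTransform, inv_mul_cancel_right]
  unfold orbitDist
  rw [hr]

/-- The classical vacuum `1̄` is at orbit distance `0`. [folklore] -/
theorem orbitDist_one : orbitDist (L := L) (fun _ => (1 : SU2)) = 0 := by
  refine le_antisymm ?_ (orbitDist_nonneg _)
  refine (orbitDist_le 1 _).trans (le_of_eq ?_)
  unfold gaugeDist
  refine Finset.sum_eq_zero fun e _ => ?_
  simp [gaugeTransform, frobNorm_zero]

/-- **Pure gauges are at orbit distance `0`**: `orbitDist (gaugeTransform g 1̄) = 0`. [folklore] -/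
theorem orbitDist_pureGauge (g : Site 3 L → SU2) : orbitDist (gaugeTransform g (fun _ : Edge 3 L => (1 : SU2))) = 0 := by
  rw [orbitDist_gaugeTransform, orbitDist_one]

/-! ## §3 Link-Lipschitz continuity -/

omit [NeZero L] in
/-- A simultaneous gauge transformation does not change link distances: `‖(U^g)_e − (V^g)_e‖_F = ‖U_e − V_e‖_F`. [folklore] -/
theorem frobNorm_gaugeTransform_sub (g : Site 3 L → SU2) (U V : GaugeConfig 3 L SU2) (e : Edge 3 L) :
    frobNorm (((gaugeTransform g U e : SU2) : Matrix (Fin 2) (Fin 2) ℂ) - ((gaugeTransform g V e : SU2) : Matrix (Fin 2) (Fin 2) ℂ)) =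
      frobNorm (((U e : SU2) : Matrix (Fin 2) (Fin 2) ℂ) - ((V e : SU2) : Matrix (Fin 2) (Fin 2) ℂ)) := by
  simp only [gaugeTransform, Submonoid.coe_mul]
  have e1 : (((g e.1 : SU2) : Matrix (Fin 2) (Fin 2) ℂ) * ((U e : SU2) : Matrix (Fin 2) (Fin 2) ℂ) *
        (((g (e.1.shift e.2))⁻¹ : SU2) : Matrix (Fin 2) (Fin 2) ℂ)) -
      (((g e.1 : SU2) : Matrix (Fin 2) (Fin 2) ℂ) * ((V e : SU2) : Matrix (Fin 2) (Fin 2) ℂ) *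
        (((g (e.1.shift e.2))⁻¹ : SU2) : Matrix (Fin 2) (Fin 2) ℂ)) =
      ((g e.1 : SU2) : Matrix (Fin 2) (Fin 2) ℂ) * (((U e : SU2) : Matrix (Fin 2) (Fin 2) ℂ) - ((V e : SU2) : Matrix (Fin 2) (Fin 2) ℂ)) *
        (((g (e.1.shift e.2))⁻¹ : SU2) : Matrix (Fin 2) (Fin 2) ℂ) := by
    rw [Matrix.mul_sub, Matrix.sub_mul]
  rw [e1, frobNorm_mul_unitary _ (su2_mem_unitaryGroup _), frobNorm_unitary_mul (su2_mem_unitaryGroup _)]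

/-- Triangle inequality for the Frobenius norm. [folklore] -/
theorem frobNorm_add_le' (A B : Matrix (Fin 2) (Fin 2) ℂ) : frobNorm (A + B) ≤ frobNorm A + frobNorm B := by
  rw [frobNorm_eq_norm, frobNorm_eq_norm, frobNorm_eq_norm]; exact norm_add_le A B

/-- `gaugeDist g` is link-Lipschitz with constant `1`, uniformly in `g`. [folklore] -/
theorem gaugeDist_le_gaugeDist_add (g : Site 3 L → SU2) (U V : GaugeConfig 3 L SU2) :
    gaugeDist g U ≤ gaugeDist g V +
      ∑ e : Edge 3 L, frobNorm (((U e : SU2) : Matrix (Fin 2) (Fin 2) ℂ) - ((V e : SU2) : Matrix (Fin 2) (Fin 2) ℂ)) := by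
  unfold gaugeDist
  rw [← Finset.sum_add_distrib]
  refine Finset.sum_le_sum fun e _ => ?_
  rw [← frobNorm_gaugeTransform_sub g U V e]
  have h : ((gaugeTransform g U e : SU2) : Matrix (Fin 2) (Fin 2) ℂ) - 1 =
      (((gaugeTransform g V e : SU2) : Matrix (Fin 2) (Fin 2) ℂ) - 1) +
        (((gaugeTransform g U e : SU2) : Matrix (Fin 2) (Fin 2) ℂ) - ((gaugeTransform g V e : SU2) : Matrix (Fin 2) (Fin 2) ℂ)) := by abel
  rw [h]
  exact frobNorm_add_le' _ _

/-- ★ **`orbitDist` is link-Lipschitz with constant `1`**: `|orbitDist U − orbitDist V| ≤ Σ_e ‖U_e − V_e‖_F`. [folklore] -/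
theorem abs_orbitDist_sub_le (U V : GaugeConfig 3 L SU2) :
    |orbitDist U - orbitDist V| ≤
      ∑ e : Edge 3 L, frobNorm (((U e : SU2) : Matrix (Fin 2) (Fin 2) ℂ) - ((V e : SU2) : Matrix (Fin 2) (Fin 2) ℂ)) := by
  set D := ∑ e : Edge 3 L, frobNorm (((U e : SU2) : Matrix (Fin 2) (Fin 2) ℂ) - ((V e : SU2) : Matrix (Fin 2) (Fin 2) ℂ)) with hD
  have hDsymm : ∑ e : Edge 3 L, frobNorm (((V e : SU2) : Matrix (Fin 2) (Fin 2) ℂ) - ((U e : SU2) : Matrix (Fin 2) (Fin 2) ℂ)) = D := by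
    refine Finset.sum_congr rfl fun e _ => ?_
    rw [← frobNorm_neg]; congr 1; abel
  obtain ⟨gU, hgU⟩ := exists_orbitDist_eq U
  obtain ⟨gV, hgV⟩ := exists_orbitDist_eq V
  have h1 : orbitDist U ≤ orbitDist V + D := by
    rw [← hgV]
    exact (orbitDist_le gV U).trans (gaugeDist_le_gaugeDist_add gV U V)
  have h2 : orbitDist V ≤ orbitDist U + D := by
    rw [← hgU, ← hDsymm]
    exact (orbitDist_le gU V).trans (gaugeDist_le_gaugeDist_add gU V U)
  rw [abs_le]; constructor <;> linarith

omit [NeZero L] in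
/-- Composite centre twists do not change link distances between configurations: `‖(τU)_e − (τV)_e‖_F = ‖U_e − V_e‖_F`. [folklore] -/
theorem frobNorm_twist3_sub (z : Fin 3 → Bool) (U V : GaugeConfig 3 L SU2) (e : Edge 3 L) :
    frobNorm (((TT.twist3 z U e : SU2) : Matrix (Fin 2) (Fin 2) ℂ) - ((TT.twist3 z V e : SU2) : Matrix (Fin 2) (Fin 2) ℂ)) =
      frobNorm (((U e : SU2) : Matrix (Fin 2) (Fin 2) ℂ) - ((V e : SU2) : Matrix (Fin 2) (Fin 2) ℂ)) := by
  rw [TT.twist3_apply, TT.twist3_apply, Submonoid.coe_mul, Submonoid.coe_mul, ← Matrix.mul_sub,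
    frobNorm_unitary_mul (su2_mem_unitaryGroup _)]

/-- The twisted orbit distances `U ↦ orbitDist (twist3 z U)` are link-Lipschitz with constant `1` too. [folklore] -/
theorem abs_orbitDist_twist3_sub_le (z : Fin 3 → Bool) (U V : GaugeConfig 3 L SU2) :
    |orbitDist (TT.twist3 z U) - orbitDist (TT.twist3 z V)| ≤
      ∑ e : Edge 3 L, frobNorm (((U e : SU2) : Matrix (Fin 2) (Fin 2) ℂ) - ((V e : SU2) : Matrix (Fin 2) (Fin 2) ℂ)) := by
  have h := abs_orbitDist_sub_le (TT.twist3 z U) (TT.twist3 z V)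
  simp only [frobNorm_twist3_sub] at h
  exact h

/-- The twisted orbit distances are gauge invariant (gauge transformations commute with centre twists). [folklore] -/
theorem orbitDist_twist3_gaugeTransform (z : Fin 3 → Bool) (h : Site 3 L → SU2) (U : GaugeConfig 3 L SU2) :
    orbitDist (TT.twist3 z (gaugeTransform h U)) = orbitDist (TT.twist3 z U) := by
  rw [← TT.gaugeTransform_twist3, orbitDist_gaugeTransform]

/-! ## §4 Continuity and measurability -/

/-- `orbitDist` is continuous (infimum of a jointly continuous function over a compact set). [folklore] -/
theorem continuous_orbitDist : Continuous (orbitDist (L := L)) := by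
  have h : (orbitDist (L := L)) = fun U => sInf ((fun g : Site 3 L → SU2 => gaugeDist g U) '' Set.univ) := by
    funext U; rw [orbitDist, Set.image_univ]
  rw [h]
  exact isCompact_univ.continuous_sInf (f := fun (U : GaugeConfig 3 L SU2) (g : Site 3 L → SU2) => gaugeDist g U)
    continuous_gaugeDist_uncurry

/-- `orbitDist` is measurable. [folklore] -/
theorem measurable_orbitDist : Measurable (orbitDist (L := L)) := by
  haveI := secondCountableTopology_su2
  exact continuous_orbitDist.measurable

/-- The twisted orbit distances are measurable. [folklore] -/
theorem measurable_orbitDist_twist3 (z : Fin 3 → Bool) : Measurable fun U : GaugeConfig 3 L SU2 => orbitDist (TT.twist3 z U) := by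
  haveI := secondCountableTopology_su2
  refine continuous_orbitDist.measurable.comp ?_
  refine measurable_pi_lambda _ fun e => ?_
  have h : (fun U : GaugeConfig 3 L SU2 => TT.twist3 z U e) =
      fun U => (if e.1 e.2 = 0 then TT.centreElem (z e.2) else 1) * U e := by
    funext U; exact TT.twist3_apply z U e
  rw [h]
  exact (measurable_pi_apply e).const_mul _

end Summit.QuantumFields.YangMills.Theorems.FemtoTransferGap

end
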